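import Mathlib
import Literature.MathematicalPhysics.StatisticalMechanics.LennardJonesClusters

/-!
# Blame counting: unmatched sites are at most `C(δ₀, D)` times the blamed sites

For a `δ₀`-separated configuration `y : Fin N → ℝ³` (all mutual distances `≥ δ₀ > 0`) and two
predicates `P`, `Q` on the sites such that every site failing `P` has a site satisfying `Q`
within distance `D > 0`, the number of sites failing `P` is at most `(2D/δ₀ + 1)³` times the
number of sites satisfying `Q`, uniformly in `N` and `y`.

This is the bookkeeping step converting "every unmatched good site has a locally bad site within
a fixed distance" (kinematics) and a bound on the number of locally bad sites (energetics) into a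
bound on the number of unmatched sites.

Proof: choose for every bad site `i` (`¬ P i`) a blamed site `b i` with `Q (b i)` and
`|yᵢ - y_{b i}| ≤ D`. The fibre of `b` over a fixed `j` consists of `δ₀`-separated points of the
ball of radius `D` about `y j`, so by the packing bound `card_le_of_separated_of_dist_le` it has
at most `(2D/δ₀ + 1)³` elements; summing over the sites `j` with `Q j`
(`Finset.card_eq_sum_card_fiberwise`) gives the claim.
-/

namespace Summit.AtomisticToContinuum.Crystallization.Theorems.PricedHcpWindowsBlameCount

open Literature.MathematicalPhysics.StatisticalMechanics

/-- **Blame counting.** For `δ₀ > 0` and `D > 0` there is `C ≥ 0` (namely `C = (2D/δ₀ + 1)³`)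
such that for every configuration `y : Fin N → ℝ³` with mutual distances `≥ δ₀` and all
predicates `P`, `Q` on `Fin N` with the blame property "every `i` with `¬ P i` has some `j` with
`Q j` and `|yᵢ - yⱼ| ≤ D`", `#{i | ¬ P i} ≤ C · #{j | Q j}`. Each fibre of a blame map
`i ↦ j` is a `δ₀`-separated subset of a ball of radius `D`, hence has `≤ (2D/δ₀ + 1)³` elements
by the packing bound `card_le_of_separated_of_dist_le`. [folklore] -/
theorem stub_blameCount : ∀ δ₀ D : ℝ, 0 < δ₀ → 0 < D → ∃ C : ℝ, 0 ≤ C ∧ ∀ (N : ℕ) (y : Fin N → EuclideanSpace ℝ (Fin 3)), (∀ i j : Fin N, i ≠ j → δ₀ ≤ dist (y i) (y j)) → ∀ (P Q : Fin N → Prop), (∀ i : Fin N, ¬ P i → ∃ j : Fin N, Q j ∧ dist (y i) (y j) ≤ D) → (Nat.card {i : Fin N // ¬ P i} : ℝ) ≤ C * (Nat.card {j : Fin N // Q j} : ℝ) := by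
  intro δ₀ D hδ₀ hD
  refine ⟨(2 * D / δ₀ + 1) ^ 3, by positivity, ?_⟩
  intro N y hsep P Q hblame
  classical
  -- `y` is injective, by separation
  have hinj : Function.Injective y := by
    intro i j hij
    by_contra h
    have h1 := hsep i j h
    rw [hij, dist_self] at h1
    exact absurd h1 (not_le.2 hδ₀)
  -- the blame map: a bad site `i` (`¬ P i`) is sent to a site `b i` with `Q (b i)` within `D`
  let b : Fin N → Fin N := fun i => if h : ¬ P i then Classical.choose (hblame i h) else i
  have hb : ∀ i, ¬ P i → Q (b i) ∧ dist (y i) (y (b i)) ≤ D := by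
    intro i hi
    simp only [b, dif_pos hi]
    exact Classical.choose_spec (hblame i hi)
  -- the two finite sets being compared
  set bad : Finset (Fin N) := Finset.univ.filter (fun i => ¬ P i) with hbad
  set blamed : Finset (Fin N) := Finset.univ.filter (fun j => Q j) with hblamed
  have hcard_bad : Nat.card {i : Fin N // ¬ P i} = bad.card := by
    rw [Nat.card_eq_fintype_card, Fintype.card_subtype]
  have hcard_blamed : Nat.card {j : Fin N // Q j} = blamed.card := by
    rw [Nat.card_eq_fintype_card, Fintype.card_subtype]
  -- `b` maps the bad set into the blamed set
  have hmaps : Set.MapsTo b (bad : Set (Fin N)) (blamed : Set (Fin N)) := by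
    intro i hi
    have hi' : ¬ P i := (Finset.mem_filter.1 (Finset.mem_coe.1 hi)).2
    exact Finset.mem_coe.2 (Finset.mem_filter.2 ⟨Finset.mem_univ _, (hb i hi').1⟩)
  -- each fibre of `b` has at most `C` elements, by the packing bound
  have hfibre : ∀ j : Fin N,
      ((bad.filter (fun i => b i = j)).card : ℝ) ≤ (2 * D / δ₀ + 1) ^ 3 := by
    intro j
    set F : Finset (Fin N) := bad.filter (fun i => b i = j) with hF
    have hmemF : ∀ i ∈ F, ¬ P i ∧ b i = j := fun i hi => by
      have h1 := Finset.mem_filter.1 hi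
      exact ⟨(Finset.mem_filter.1 h1.1).2, h1.2⟩
    have h1 : ((F.image y).card : ℝ) = (F.card : ℝ) := by
      rw [Finset.card_image_of_injective F hinj]
    have h2 := card_le_of_separated_of_dist_le (F.image y) (y j) hδ₀ hD.le ?_ ?_
    · rw [finrank_euclideanSpace_fin] at h2
      rw [← h1]
      exact h2
    · intro c hc
      obtain ⟨i, hi, rfl⟩ := Finset.mem_image.1 hc
      obtain ⟨hPi, hbi⟩ := hmemF i hi
      have h3 := (hb i hPi).2
      rwa [hbi] at h3
    · intro c hc d hd hcd
      obtain ⟨i, hi, rfl⟩ := Finset.mem_image.1 hc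
      obtain ⟨i', hi', rfl⟩ := Finset.mem_image.1 hd
      exact hsep i i' (fun h => hcd (by rw [h]))
  -- decompose the bad set along the fibres of `b` and sum the fibre bounds
  have hsum : (bad.card : ℝ) = ∑ j ∈ blamed, ((bad.filter (fun i => b i = j)).card : ℝ) := by
    rw [Finset.card_eq_sum_card_fiberwise hmaps]
    push_cast
    rfl
  rw [hcard_bad, hcard_blamed, hsum]
  calc ∑ j ∈ blamed, ((bad.filter (fun i => b i = j)).card : ℝ)
      ≤ ∑ j ∈ blamed, (2 * D / δ₀ + 1) ^ 3 := Finset.sum_le_sum (fun j _ => hfibre j)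
    _ = (2 * D / δ₀ + 1) ^ 3 * (blamed.card : ℝ) := by
      rw [Finset.sum_const, nsmul_eq_mul, mul_comm]

end Summit.AtomisticToContinuum.Crystallization.Theorems.PricedHcpWindowsBlameCount
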